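import Mathlib
import HarnessLib.Audit
import Summits.PneNP.PneNP.Theorems.PstarCircuitJoins
import Summits.PneNP.PneNP.Theorems.PstarReleaseBlockJoin
import Summits.PneNP.PneNP.Theorems.PstarCoreKillsEvens

/-!
# The pinning table of a cycle core: (P1)/(P2) by name (ROUND-24, O1; memo g28 §79)

FRONTIER range-avoidance ladder, rung F-N3, ROUND 24 (cell `pnp-ideate`, prover-2 memo `g28/O1-JOINS-g28.md` §79; census node
`PstarLocalGateBudgetAssembly.LocalMenuCriterionBoundGateBudget`; restricted-model proof complexity — nothing here bears on `P` versus `NP`).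

`PstarLiteralPinningCriterion.constant_iff_block_join` (memo g27 §70): a literal `s` with private partners is constant on the slice
`A = Sol(K) ∩ {Γ₁ = b₁}` iff some ONE-BLOCK JOIN through `s` has value `1`.  `PstarCircuitJoins` lists the joins of an even circuit core (a cycle
core `C₃, C₄, C₅` of the census) as `(∅,0)`, `(K,0)`, `(P,1)`, `(K ∖ P,1)` for any one join `P` with the reader.  This file spells the criterion out:

* `exists_join_iff` — the existential dual of `PstarCircuitJoins.forall_join_iff`: «some join has property `R`» iff one of the four candidates has;
* **`constant_iff_cycle`** — on a cycle core, `x_s` is A-constant iff the WHOLE CORE passes through `s` with `v(K,0) = 1`, or an ARC TOGETHER WITH ALL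
  FOLDS passes through `s` with value `1` (`P ∪ G₁` with `v(P,1) = 1`, or `(K ∖ P) ∪ G₁` with `v(K ∖ P,1) = 1`) — p3's «one-block value-1 path»;
* **`both_values_of_genuine_arcs`** — (P1): if the core is not inside `s`'s block and neither arc-with-folds is (two GENUINE two-block arcs), then
  `x_s` takes both values on the slice — nothing is pinned;
* **`release_on_cycle`** — a transparent half-free release gate `(s, π)` of a terminal cycle core (`PstarReleaseBlockJoin.block_join_of_release`)
  therefore sits over an arc-with-all-folds inside `s`'s block of value `1` (or the whole core inside the block with `v(K,0) = 1`): the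
  «transparency ⟹ one-label 2-route» lemma of p3 memo r24 §14.70, for all `k`;
* (appended) **`constant_cases_of_evens`**, **`release_on_evens`** — the same two statements on a GENERAL core from the list of its even
  subfamilies (`PstarCoreKillsEvens.block_join_cases_of_evens`): theta cores `K₄ − e`, where p3's K43 census located every admissible release.
-/

set_option linter.dupNamespace false -- `Summit.PneNP.PneNP.…`: summit = sub-problem name (D-0017 single-conjunct layout)

open Finset Literature.Computability.Complexity
open Summit.PneNP.PneNP.Theorems.PstarTyped (Typed)
open Summit.PneNP.PneNP.Theorems.PstarSALevel (varSet BoundaryExpanding SimpleOverlap)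
open Summit.PneNP.PneNP.Theorems.PstarCoreBoundTargets (Terminal)
open Summit.PneNP.PneNP.Theorems.PstarChordBridgeTools (xpdeg)
open Summit.PneNP.PneNP.Theorems.PstarLiteralPinning (Through InSlice IsJoin joinValue exists_false_of_no_block_join)
open Summit.PneNP.PneNP.Theorems.PstarLiteralPinningCriterion (exists_true_of_slice constant_iff_block_join)
open Summit.PneNP.PneNP.Theorems.PstarReleaseBlockJoin (block_join_of_release)
open Summit.PneNP.PneNP.Theorems.PstarCircuitJoins (isJoin_empty isJoin_false_iff isJoin_sdiff join_cases joinValue_empty)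

namespace Summit.PneNP.PneNP.Theorems.PstarCycleCorePinning

variable {n m : ℕ} (I : LocalMap 4 n m)

/-- **THE EXISTENTIAL DUAL**: on an even circuit core with a join `P` (with the reader), «some join `(D, t)` has property `R`» iff one of the four
candidates `(∅,0)`, `(K,0)`, `(P,1)`, `(K ∖ P,1)` has. -/
theorem exists_join_iff {K : Finset (Fin m)} (hKev : ∀ w, Even (xpdeg I K w)) (hmin : ∀ D ⊆ K, (∀ w, Even (xpdeg I D w)) → D = ∅ ∨ D = K)
    {C : Finset (Fin n)} {P : Finset (Fin m)} (hP : P ⊆ K) (hPJ : IsJoin I C P true) (R : Finset (Fin m) → Bool → Prop) :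
    (∃ D ⊆ K, ∃ t : Bool, IsJoin I C D t ∧ R D t) ↔ R ∅ false ∨ R K false ∨ R P true ∨ R (K \ P) true := by
  constructor
  · rintro ⟨D, hD, t, hJ, hR⟩
    rcases join_cases I hmin hP hPJ hD hJ with ⟨rfl, rfl | rfl⟩ | ⟨rfl, rfl | rfl⟩
    · exact Or.inl hR
    · exact Or.inr (Or.inl hR)
    · exact Or.inr (Or.inr (Or.inl hR))
    · exact Or.inr (Or.inr (Or.inr hR))
  · rintro (h | h | h | h)
    · exact ⟨∅, empty_subset _, false, isJoin_empty I C, h⟩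
    · exact ⟨K, Subset.rfl, false, (isJoin_false_iff I C K).2 hKev, h⟩
    · exact ⟨P, hP, true, hPJ, h⟩
    · exact ⟨K \ P, sdiff_subset, true, isJoin_sdiff I hKev hP hPJ, h⟩

variable {I} {y : Fin m → Bool} {K P : Finset (Fin m)} {w₁ w₂ : Finset (Fin n) × Finset (Fin m) × Bool} {s : Fin n}

/-- **THE PINNING TABLE OF A CYCLE CORE.**  Typed pure instance; `K` an even circuit with a join `P` for the reader `w₁ = (C₁, G₁, b₁)`; `K ∩ G₁ = ∅`;
`C₁` off the AND variables of `K ∪ G₁`; the literal `s` is no XOR variable of `K`, `s ∉ C₁`, its partners are PRIVATE and every other output of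
`K ∪ G₁` has a private AND variable; the slice is non-empty.  Then `x_s` is constant on the slice iff the whole core lies in `s`'s block with
`v(K,0) = 1`, or one of the two arcs TOGETHER WITH ALL FOLDS lies in `s`'s block and has value `1`. -/
theorem constant_iff_cycle (hI : I.IsPure xorAndPred) (hT : Typed I) (hKG : Disjoint K w₁.2.1)
    (hKev : ∀ w, Even (xpdeg I K w)) (hmin : ∀ D ⊆ K, (∀ w, Even (xpdeg I D w)) → D = ∅ ∨ D = K)
    (hP : P ⊆ K) (hPJ : IsJoin I w₁.1 P true)
    (hC₁ : ∀ v ∈ w₁.1, ∀ j ∈ K ∪ w₁.2.1, ¬ Through I v j) (hsX : ∀ j ∈ K, I.vars j 0 ≠ s ∧ I.vars j 1 ≠ s) (hsC : s ∉ w₁.1)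
    (hpart : ∀ j ∈ K ∪ w₁.2.1, ∀ w, (I.vars j 2 = s ∧ I.vars j 3 = w) ∨ (I.vars j 2 = w ∧ I.vars j 3 = s) →
      w ∉ w₁.1 ∧ (∀ j' ∈ K, I.vars j' 0 ≠ w ∧ I.vars j' 1 ≠ w) ∧ ∀ j' ∈ K ∪ w₁.2.1, Through I w j' → j' = j)
    (hfree : ∀ j ∈ K ∪ w₁.2.1, ¬ Through I s j → ∃ p, Through I p j ∧ ∀ j' ∈ K ∪ w₁.2.1, Through I p j' → j' = j)
    (hne : ∃ x, InSlice I y K w₁ x) :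
    (∃ e, ∀ z, InSlice I y K w₁ z → z s = e) ↔
      ((∀ j ∈ K, Through I s j) ∧ joinValue y w₁.2.2 K false = 1) ∨
      ((∀ j ∈ P, Through I s j) ∧ (∀ g ∈ w₁.2.1, Through I s g) ∧ joinValue y w₁.2.2 P true = 1) ∨
      ((∀ j ∈ K \ P, Through I s j) ∧ (∀ g ∈ w₁.2.1, Through I s g) ∧ joinValue y w₁.2.2 (K \ P) true = 1) := by
  rw [constant_iff_block_join hI hT hKG hC₁ hsX hsC hpart hfree hne]
  have key := exists_join_iff I hKev hmin hP hPJ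
    (fun D t => (∀ j ∈ D, Through I s j) ∧ (t = true → ∀ g ∈ w₁.2.1, Through I s g) ∧ joinValue y w₁.2.2 D t = 1)
  beta_reduce at key
  rw [key]
  constructor
  · rintro (h | h | h | h)
    · exact absurd h.2.2 (by rw [joinValue_empty]; exact zero_ne_one)
    · exact Or.inl ⟨h.1, h.2.2⟩
    · exact Or.inr (Or.inl ⟨h.1, h.2.1 rfl, h.2.2⟩)
    · exact Or.inr (Or.inr ⟨h.1, h.2.1 rfl, h.2.2⟩)
  · rintro (h | h | h)
    · exact Or.inr (Or.inl ⟨h.1, fun hf => absurd hf (by decide), h.2⟩)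
    · exact Or.inr (Or.inr (Or.inl ⟨h.1, fun _ => h.2.1, h.2.2⟩))
    · exact Or.inr (Or.inr (Or.inr ⟨h.1, fun _ => h.2.1, h.2.2⟩))

/-- **(P1): GENUINE ARCS PIN NOTHING.**  Under the hypotheses of `constant_iff_cycle`: if the core is not inside `s`'s block (some member off `s`, or
`v(K,0) = 0`) and neither arc-with-folds is inside `s`'s block with value `1`, then `x_s` takes BOTH values on the slice. -/
theorem both_values_of_genuine_arcs (hI : I.IsPure xorAndPred) (hT : Typed I) (hKG : Disjoint K w₁.2.1)
    (hKev : ∀ w, Even (xpdeg I K w)) (hmin : ∀ D ⊆ K, (∀ w, Even (xpdeg I D w)) → D = ∅ ∨ D = K)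
    (hP : P ⊆ K) (hPJ : IsJoin I w₁.1 P true)
    (hC₁ : ∀ v ∈ w₁.1, ∀ j ∈ K ∪ w₁.2.1, ¬ Through I v j) (hsX : ∀ j ∈ K, I.vars j 0 ≠ s ∧ I.vars j 1 ≠ s) (hsC : s ∉ w₁.1)
    (hpart : ∀ j ∈ K ∪ w₁.2.1, ∀ w, (I.vars j 2 = s ∧ I.vars j 3 = w) ∨ (I.vars j 2 = w ∧ I.vars j 3 = s) →
      w ∉ w₁.1 ∧ (∀ j' ∈ K, I.vars j' 0 ≠ w ∧ I.vars j' 1 ≠ w) ∧ ∀ j' ∈ K ∪ w₁.2.1, Through I w j' → j' = j)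
    (hfree : ∀ j ∈ K ∪ w₁.2.1, ¬ Through I s j → ∃ p, Through I p j ∧ ∀ j' ∈ K ∪ w₁.2.1, Through I p j' → j' = j)
    (hne : ∃ x, InSlice I y K w₁ x)
    (hK : (∀ j ∈ K, Through I s j) → joinValue y w₁.2.2 K false ≠ 1)
    (hA : (∀ j ∈ P, Through I s j) → (∀ g ∈ w₁.2.1, Through I s g) → joinValue y w₁.2.2 P true ≠ 1)
    (hA' : (∀ j ∈ K \ P, Through I s j) → (∀ g ∈ w₁.2.1, Through I s g) → joinValue y w₁.2.2 (K \ P) true ≠ 1) :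
    (∃ z, InSlice I y K w₁ z ∧ z s = false) ∧ ∃ z, InSlice I y K w₁ z ∧ z s = true := by
  have hnot : ¬ ∃ e, ∀ z, InSlice I y K w₁ z → z s = e := by
    rw [constant_iff_cycle hI hT hKG hKev hmin hP hPJ hC₁ hsX hsC hpart hfree hne]
    rintro (h | h | h)
    · exact hK h.1 h.2
    · exact hA h.1 h.2.1 h.2.2
    · exact hA' h.1 h.2.1 h.2.2
  obtain ⟨x, hx⟩ := hne
  obtain ⟨z₁, hz₁, hz₁s⟩ := exists_true_of_slice hI hsX hsC hpart hx
  refine ⟨?_, z₁, hz₁, hz₁s⟩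
  by_contra h
  push Not at h
  exact hnot ⟨true, fun z hz => by
    have := h z hz
    revert this; cases z s <;> simp⟩

variable {r : ℕ} {g : Fin m} {π : Fin n}

/-- **A TRANSPARENT RELEASE ON A CYCLE CORE SITS OVER A ONE-LABEL ARC** (p3 memo r24 §14.70: transparency ⟹ `K₄ − e` completion).  A terminal
pair on an even circuit core, a half-free release gate `(s, π) ∈ G₂ ∖ G₁` (as in `PstarReleaseBlockJoin.block_join_of_release`): then the whole core
lies in `s`'s block with `v(K,0) = 1`, or an arc together with all folds lies in `s`'s block and has value `1`. -/
theorem release_on_cycle (hI : I.IsPure xorAndPred) (hT : Typed I) (hS : SimpleOverlap I) (hB : BoundaryExpanding r I)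
    (ht : Terminal I r y K w₁ w₂) (hKev : ∀ w, Even (xpdeg I K w)) (hmin : ∀ D ⊆ K, (∀ w, Even (xpdeg I D w)) → D = ∅ ∨ D = K)
    (hP : P ⊆ K) (hPJ : IsJoin I w₁.1 P true)
    (hslots : (I.vars g 2 = s ∧ I.vars g 3 = π) ∨ (I.vars g 2 = π ∧ I.vars g 3 = s)) (hg₂ : g ∈ w₂.2.1)
    (hg₁ : g ∉ w₁.2.1) (hπK : ∀ j ∈ K, π ∉ varSet I j) (hπG : ∀ g' ∈ w₁.2.1 ∪ w₂.2.1, g' ≠ g → I.vars g' 2 ≠ π ∧ I.vars g' 3 ≠ π)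
    (hπC₁ : π ∉ w₁.1) (hsX : ∀ j ∈ K, I.vars j 0 ≠ s ∧ I.vars j 1 ≠ s) (hsC : s ∉ w₁.1)
    (hC₁ : ∀ v ∈ w₁.1, ∀ j ∈ K ∪ w₁.2.1, ¬ Through I v j)
    (hpart : ∀ j ∈ K ∪ w₁.2.1, ∀ w, (I.vars j 2 = s ∧ I.vars j 3 = w) ∨ (I.vars j 2 = w ∧ I.vars j 3 = s) →
      w ∉ w₁.1 ∧ (∀ j' ∈ K, I.vars j' 0 ≠ w ∧ I.vars j' 1 ≠ w) ∧ ∀ j' ∈ K ∪ w₁.2.1, Through I w j' → j' = j)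
    (hfree : ∀ j ∈ K ∪ w₁.2.1, ¬ Through I s j → ∃ p, Through I p j ∧ ∀ j' ∈ K ∪ w₁.2.1, Through I p j' → j' = j) :
    ((∀ j ∈ K, Through I s j) ∧ joinValue y w₁.2.2 K false = 1) ∨
      ((∀ j ∈ P, Through I s j) ∧ (∀ g' ∈ w₁.2.1, Through I s g') ∧ joinValue y w₁.2.2 P true = 1) ∨
      ((∀ j ∈ K \ P, Through I s j) ∧ (∀ g' ∈ w₁.2.1, Through I s g') ∧ joinValue y w₁.2.2 (K \ P) true = 1) := by
  obtain ⟨D, hD, t, hJ, hDs, hGs, hval⟩ :=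
    block_join_of_release hI hT hS hB ht hslots hg₂ hg₁ hπK hπG hπC₁ hsX hsC hC₁ hpart hfree
  rcases join_cases I hmin hP hPJ hD hJ with ⟨rfl, rfl | rfl⟩ | ⟨rfl, rfl | rfl⟩
  · exact absurd hval (by rw [joinValue_empty]; exact zero_ne_one)
  · exact Or.inl ⟨hDs, hval⟩
  · exact Or.inr (Or.inl ⟨hDs, hGs rfl, hval⟩)
  · exact Or.inr (Or.inr ⟨hDs, hGs rfl, hval⟩)


/-! ## General cores: the pinning table and the release rule from the even list (appended, memo g28 §79b) -/

section Evens

open Summit.PneNP.PneNP.Theorems.PstarCoreKillsEvens (block_join_cases_of_evens)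

variable {L : Finset (Finset (Fin m))}

/-- **PINNED LITERALS ON A GENERAL CORE.**  Hypotheses of `PstarLiteralPinningCriterion.constant_iff_block_join`; `L` contains every even subfamily
of `K`; `P` a join with the reader.  If `x_s` is constant on the slice then, for some `E ∈ L`, either `E` lies in `s`'s block with `v(E,0) = 1`, or
`P ∆ E` together with all folds lies in `s`'s block with `v(P ∆ E, 1) = 1`. -/
theorem constant_cases_of_evens (hI : I.IsPure xorAndPred) (hT : Typed I) (hKG : Disjoint K w₁.2.1)
    (hL : ∀ E ⊆ K, (∀ w, Even (xpdeg I E w)) → E ∈ L) (hP : P ⊆ K) (hPJ : IsJoin I w₁.1 P true)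
    (hC₁ : ∀ v ∈ w₁.1, ∀ j ∈ K ∪ w₁.2.1, ¬ Through I v j) (hsX : ∀ j ∈ K, I.vars j 0 ≠ s ∧ I.vars j 1 ≠ s) (hsC : s ∉ w₁.1)
    (hpart : ∀ j ∈ K ∪ w₁.2.1, ∀ w, (I.vars j 2 = s ∧ I.vars j 3 = w) ∨ (I.vars j 2 = w ∧ I.vars j 3 = s) →
      w ∉ w₁.1 ∧ (∀ j' ∈ K, I.vars j' 0 ≠ w ∧ I.vars j' 1 ≠ w) ∧ ∀ j' ∈ K ∪ w₁.2.1, Through I w j' → j' = j)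
    (hfree : ∀ j ∈ K ∪ w₁.2.1, ¬ Through I s j → ∃ p, Through I p j ∧ ∀ j' ∈ K ∪ w₁.2.1, Through I p j' → j' = j)
    (hne : ∃ x, InSlice I y K w₁ x) (hconst : ∃ b, ∀ z, InSlice I y K w₁ z → z s = b) :
    ∃ E ∈ L, ((∀ j ∈ E, Through I s j) ∧ joinValue y w₁.2.2 E false = 1) ∨
      ((∀ j ∈ (P \ E) ∪ (E \ P), Through I s j) ∧ (∀ g ∈ w₁.2.1, Through I s g) ∧ joinValue y w₁.2.2 ((P \ E) ∪ (E \ P)) true = 1) :=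
  block_join_cases_of_evens hL hP hPJ ((constant_iff_block_join hI hT hKG hC₁ hsX hsC hpart hfree hne).1 hconst)

/-- **A TRANSPARENT RELEASE ON A GENERAL CORE** (theta cores: the `K₄ − e` pins): under the hypotheses of `release_on_cycle` with the circuit
hypothesis replaced by the even list `L`, the release gate's literal `s` carries, for some `E ∈ L`, the even subfamily `E` inside its block with
`v(E,0) = 1` or the shifted arc `P ∆ E` with all folds inside its block with `v(P ∆ E,1) = 1`. -/
theorem release_on_evens (hI : I.IsPure xorAndPred) (hT : Typed I) (hS : SimpleOverlap I) (hB : BoundaryExpanding r I)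
    (ht : Terminal I r y K w₁ w₂) (hL : ∀ E ⊆ K, (∀ w, Even (xpdeg I E w)) → E ∈ L) (hP : P ⊆ K) (hPJ : IsJoin I w₁.1 P true)
    (hslots : (I.vars g 2 = s ∧ I.vars g 3 = π) ∨ (I.vars g 2 = π ∧ I.vars g 3 = s)) (hg₂ : g ∈ w₂.2.1)
    (hg₁ : g ∉ w₁.2.1) (hπK : ∀ j ∈ K, π ∉ varSet I j) (hπG : ∀ g' ∈ w₁.2.1 ∪ w₂.2.1, g' ≠ g → I.vars g' 2 ≠ π ∧ I.vars g' 3 ≠ π)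
    (hπC₁ : π ∉ w₁.1) (hsX : ∀ j ∈ K, I.vars j 0 ≠ s ∧ I.vars j 1 ≠ s) (hsC : s ∉ w₁.1)
    (hC₁ : ∀ v ∈ w₁.1, ∀ j ∈ K ∪ w₁.2.1, ¬ Through I v j)
    (hpart : ∀ j ∈ K ∪ w₁.2.1, ∀ w, (I.vars j 2 = s ∧ I.vars j 3 = w) ∨ (I.vars j 2 = w ∧ I.vars j 3 = s) →
      w ∉ w₁.1 ∧ (∀ j' ∈ K, I.vars j' 0 ≠ w ∧ I.vars j' 1 ≠ w) ∧ ∀ j' ∈ K ∪ w₁.2.1, Through I w j' → j' = j)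
    (hfree : ∀ j ∈ K ∪ w₁.2.1, ¬ Through I s j → ∃ p, Through I p j ∧ ∀ j' ∈ K ∪ w₁.2.1, Through I p j' → j' = j) :
    ∃ E ∈ L, ((∀ j ∈ E, Through I s j) ∧ joinValue y w₁.2.2 E false = 1) ∨
      ((∀ j ∈ (P \ E) ∪ (E \ P), Through I s j) ∧ (∀ g' ∈ w₁.2.1, Through I s g') ∧ joinValue y w₁.2.2 ((P \ E) ∪ (E \ P)) true = 1) :=
  block_join_cases_of_evens hL hP hPJ (block_join_of_release hI hT hS hB ht hslots hg₂ hg₁ hπK hπG hπC₁ hsX hsC hC₁ hpart hfree)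

end Evens

end Summit.PneNP.PneNP.Theorems.PstarCycleCorePinning
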